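import Summits.Ventures.PercRepro.Night2NonFatLineCell
import Summits.Ventures.PercRepro.Night2NonFatTen

/-!
# night-2: h21's cell `(2, 1)` for `V` a plane plus at most two points — no basis pair at all (gen 37)

A basis pair `(B, z)` needs `W = G ∖ Q` of rank `≥ 4` (`four_le_rkN_sdiff_insert`).  If all but at most two points of `V = G ∖ K` lie in a set `π`
of rank `≤ 3` (a plane), the basis `Q′` (five independent points, at most three on `π`) takes both points
off `π`, so `W ⊆ π` has rank `≤ 3`: there is no basis pair, the basis pairs' fair share is vacuous and the cell's local Hall
inequality follows from the column side alone (`localShadowHall_of_gt2_of_basis_fair`).  **`localShadowHall_two_one_of_plane_plus_two`**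
(with `≥ 2` fat closures by gen 28's free theorem).  Together with `localShadowHall_two_one_of_line` (`V` = a line plus `≤ 5` points)
these are the cells of h21 whose `W` is forced onto a low-rank flat.
Paper: proofs/NIGHT-2-g37.md §5.
-/

namespace PercRepro.Shadow

open PercRepro.ThmH PercRepro.PerFlat

variable {α : Type*} [DecidableEq α] {M : Matroid α} [M.Finite] {G : Finset α}

/-- **No basis pair when `V` is a plane plus at most two points**: `W ⊆ π` would have rank `≤ 3`. -/
theorem not_basis_pair_of_plane_plus_two (hG : G ∈ flatsQ M (5 + 1)) (hd : (gr M \ G).card = 2)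
    (hk : kColoops M G = 1) {π : Finset α} (hrπ : rkN M π ≤ 3)
    (h2 : ((G \ coloops M G) \ π).card ≤ 2) {B : Finset α} (hB : B ∈ thinMembers M 5 G) (hnP : ¬ bigP M G B)
    {z : α} (hz : z ∈ G \ clF M B) : False := by
  have hd' : (gr M \ G).card ≤ 5 := by omega
  have hGg : G ⊆ gr M := (mem_flatsQ.1 hG).1
  have hBG : B ⊆ G := subset_G_of_mem_thinMembers hB
  have hQG : insert z B ⊆ G := Finset.insert_subset (Finset.mem_sdiff.1 hz).1 hBG
  have hKB : coloops M G ⊆ B := coloops_subset_of_mem_thinMembers hG hd' hB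
  have h4 := card_sdiff_eq_four_of_not_bigP hG hd hk hB hnP
  have hzB : z ∉ B := fun h => (Finset.mem_sdiff.1 hz).2 (subset_clF_of_subset_gr (hBG.trans hGg) h)
  have hQ'card : (insert z B \ coloops M G).card = 5 := by
    have h1 : insert z B \ coloops M G = insert z (B \ coloops M G) := by
      ext e
      simp only [Finset.mem_sdiff, Finset.mem_insert]
      constructor
      · rintro ⟨h | h, hK⟩
        · exact Or.inl h
        · exact Or.inr ⟨h, hK⟩
      · rintro (rfl | ⟨h, hK⟩)
        · exact ⟨Or.inl rfl, fun hK => hzB (hKB hK)⟩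
        · exact ⟨Or.inr h, hK⟩
    rw [h1, Finset.card_insert_of_notMem (fun h => hzB (Finset.mem_sdiff.1 h).1), h4]
  have hQ'rk : rkN M (insert z B \ coloops M G) = (insert z B \ coloops M G).card :=
    rkN_eq_card_of_subset_of_rkN_eq_card (rkN_insert_eq_card hG hd hk hB hnP hz) Finset.sdiff_subset
  -- at most three basis points on `π`, so at least two off it: all of `V ∖ π`
  have hQπ : ((insert z B \ coloops M G) ∩ π).card ≤ 3 := by
    have h1 := rkN_eq_card_of_subset_of_rkN_eq_card hQ'rk (Finset.inter_subset_left : (insert z B \ coloops M G) ∩ π ⊆ _)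
    have h2 := rkN_mono (M := M) (Finset.inter_subset_right : (insert z B \ coloops M G) ∩ π ⊆ π)
    omega
  have hQoff : 2 ≤ ((insert z B \ coloops M G) \ π).card := by
    have := Finset.card_sdiff_add_card_inter (insert z B \ coloops M G) π
    omega
  -- `W ∖ π` and `Q′ ∖ π` are disjoint subsets of `V ∖ π`, so `W ∖ π = ∅`
  have hWV : G \ insert z B ⊆ G \ coloops M G := by
    intro e he
    rw [Finset.mem_sdiff] at he
    exact Finset.mem_sdiff.2 ⟨he.1, fun hK => he.2 (Finset.mem_insert_of_mem (hKB hK))⟩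
  have hdisj : Disjoint ((G \ insert z B) \ π) ((insert z B \ coloops M G) \ π) := by
    rw [Finset.disjoint_left]
    intro e he1 he2
    exact (Finset.mem_sdiff.1 (Finset.mem_sdiff.1 he1).1).2 (Finset.sdiff_subset (Finset.mem_sdiff.1 he2).1)
  have hunion : ((G \ insert z B) \ π) ∪ ((insert z B \ coloops M G) \ π) ⊆ (G \ coloops M G) \ π := by
    apply Finset.union_subset
    · exact Finset.sdiff_subset_sdiff hWV (le_refl _)
    · exact Finset.sdiff_subset_sdiff (Finset.sdiff_subset_sdiff hQG (le_refl _)) (le_refl _)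
  have hcardU := Finset.card_le_card hunion
  rw [Finset.card_union_of_disjoint hdisj] at hcardU
  have hWπ : ((G \ insert z B) \ π).card = 0 := by omega
  rw [Finset.card_eq_zero, Finset.sdiff_eq_empty_iff_subset] at hWπ
  -- but `W` has rank `≥ 4`
  have hrW := four_le_rkN_sdiff_insert hd hB z
  have := rkN_mono (M := M) hWπ
  omega

/-- **h21's cell `(2, 1)` for `V` a plane plus at most two points.** -/
theorem localShadowHall_two_one_of_plane_plus_two (hG : G ∈ flatsQ M (5 + 1)) (hd : (gr M \ G).card = 2)
    (hk : kColoops M G = 1) (hs : ∀ e ∈ gr M, ∀ f ∈ gr M, e ≠ f → rkN M {e, f} = 2)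
    (hl : ∀ e ∈ gr M, M.Indep {e}) {π : Finset α} (hrπ : rkN M π ≤ 3)
    (h2 : ((G \ coloops M G) \ π).card ≤ 2) : LocalShadowHall M 5 G := by
  rcases Nat.lt_or_ge (fatClosures M 5 G 2).card 2 with hlt | hge
  · apply localShadowHall_of_gt2_of_basis_fair hG hd hk hs hl (by omega)
    intro B hB hnP z hz
    exact (not_basis_pair_of_plane_plus_two hG hd hk hrπ h2 hB hnP hz).elim
  · exact localShadowHall_two_one_five_fatClosures_free hG hd hk hs hl hge

end PercRepro.Shadow
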